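import Literature.NumberTheory.Transcendental.PseudoExpSEACStep
import Literature.NumberTheory.Transcendental.ZilberFieldGSGC
import HarnessLib

/-!
# The SEAC step of the ω-chain is a strong extension (Bays–Kirby 2018, Prop. 7.3; Kirby 2013 §3)

For the step `PState.stepSEAC` of `PseudoExpSEACStep.lean` — adjoining to a state `σ` the additive
coordinates `x̄` of a generic point `z = (x̄, ȳ)` over `k₁ ⊇ ℚ(D, E(D))` of an irreducible rotund
variety `W ⊆ 𝔾ₐⁿ × 𝔾ₘⁿ` meeting the torus, with `exp xᵢ := yᵢ` — we prove that the extension of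
domains `D ≤ D + ℚx̄` is **strong**: `δ(Y/D) ≥ 0` for every intermediate `D ≤ Y ≤ D + ℚx̄`.

The argument is that of Bays–Kirby, *Pseudo-exponential maps, variants, and quasiminimality*
(A&NT 12 (2018)), Prop. 7.3 ("the extension is strong iff for all `M`, `td(M·b/A) ≥ rk M`", i.e.
rotundity of the locus), cf. Kirby, *Finitely presented exponential fields* (A&NT 7 (2013)), §3:
a subspace `Y` with `D ≤ Y ≤ D + ℚx̄` is `D + ℚ·(M x̄)` for the integer matrix `M` of all
relations of `x̄` modulo `Y` (`ZilberGSGC.exists_relation_matrix`), `ldim(Y/D) = rk M`, and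
`td(Y/D) ≥ td([M] z / k₁) ≥ dim [M](W ∩ 𝔾ⁿ) ≥ rk M` because `z` is generic in `W ∩ 𝔾ⁿ` over `k₁`
(`ZilberGSGC.zariskiDim_image_matrixAct_le_trdeg`) and `W ∩ 𝔾ⁿ` is rotund.

## Contents

* `PState.vanishingIdeal_W_inter_torusLocus` — `I_{k₁}(W ∩ 𝔾ⁿ) = I_{k₁}(W)` (`W` irreducible
  meeting the torus);
* `PState.rank_le_relRank_k₁` — `rk M ≤ td([M] z / k₁)` from rotundity;
* `PState.predim_nonneg_stepSEAC` — the step is strong, for any total exponential on `Ω`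
  extending the partial exponential of the new state.

## References

* M. Bays, J. Kirby, A&NT 12 (2018), Prop. 7.3 and its proof.
* J. Kirby, A&NT 7 (2013), §3 (Lemma 3.3 ff.).
* B. Zilber, Ann. Pure Appl. Logic 132 (2005), §3 (rotund = "ex-normal" varieties).
-/

noncomputable section

open Set MvPolynomial

namespace Literature.NumberTheory.Transcendental

namespace PseudoExpChain

open GammaField Literature.ModelTheory.ExponentialFields
  Literature.ModelTheory.ExponentialFields.ExponentialRing

variable {A : AmbientData}

namespace PState

/-! ### Genericity in `W ∩ 𝔾ⁿ` and the rank bound -/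

section Generic

variable (σ : PState A) (h : σ.Inv) {n : ℕ} (G : Finset (MvPolynomial (Fin n ⊕ Fin n) A.Ω))
  (P : Finset A.Ω)

/-- **`I_{k₁}(W ∩ 𝔾ⁿ) = P₁ = I_{k₁}(W)`** for `W` irreducible meeting the torus: a polynomial over
`k₁` vanishing on `W ∩ 𝔾ⁿ` times `∏ Yᵢ` vanishes on `W`, and `∏ Yᵢ ∉ I(W)`. [folklore] -/
theorem vanishingIdeal_W_inter_torusLocus (hW : IsIrreducibleClosed A.Ω (W G))
    (hne : (W G ∩ torusLocus A.Ω n).Nonempty) :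
    vanishingIdeal (σ.k₁ h G P) (W G ∩ torusLocus A.Ω n) = σ.P₁ h G P := by
  ext p
  rw [mem_vanishingIdeal_iff, mem_P₁_iff]
  refine ⟨fun hp w hw => ?_, fun hp w hw => hp w hw.1⟩
  have h1 : MvPolynomial.map (algebraMap (σ.k₁ h G P) A.Ω) p * ∏ i, X (Sum.inr i) ∈
      vanishingIdeal A.Ω (W G) := by
    rw [mem_vanishingIdeal_iff]
    intro v hv
    by_cases hvT : v ∈ torusLocus A.Ω n
    · rw [map_mul, aeval_map_algebraMap, hp v ⟨hv, hvT⟩, zero_mul]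
    · simp only [mem_torusLocus_iff, not_forall, not_not] at hvT
      obtain ⟨i, hi⟩ := hvT
      rw [map_mul, map_prod]
      simp only [aeval_X]
      rw [Finset.prod_eq_zero (Finset.mem_univ i) hi, mul_zero]
  rcases hW.2.mem_or_mem h1 with h2 | h2
  · have := (mem_vanishingIdeal_iff.1 h2) w hw
    rwa [aeval_map_algebraMap] at this
  · exfalso
    obtain ⟨v, hvW, hvT⟩ := hne
    have := (mem_vanishingIdeal_iff.1 h2) v hvW
    rw [map_prod] at this
    simp only [aeval_X] at this
    exact Finset.prod_ne_zero_iff.2 (fun i _ => hvT i) this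

/-- The generic point lies in the torus. [folklore] -/
theorem genPt_mem_torusLocus (hW : IsIrreducibleClosed A.Ω (W G))
    (hne : (W G ∩ torusLocus A.Ω n).Nonempty) : σ.genPt h G P hW ∈ torusLocus A.Ω n :=
  fun i => σ.genPt_inr_ne_zero h G P hW hne i

/-- The generic point is generic in `W ∩ 𝔾ⁿ` over `k₁`. [folklore] -/
theorem isGenericPt_genPt_inter (hW : IsIrreducibleClosed A.Ω (W G))
    (hne : (W G ∩ torusLocus A.Ω n).Nonempty) :
    IsGenericPt (vanishingIdeal (σ.k₁ h G P) (W G ∩ torusLocus A.Ω n)) (σ.genPt h G P hW) := by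
  rw [σ.vanishingIdeal_W_inter_torusLocus h G P hW hne]
  exact σ.isGenericPt_genPt h G P hW

/-- **Rotundity read at the generic point**: `rk M ≤ td([M] z / k₁)` for every integer matrix
`M`, since `dim [M](W ∩ 𝔾ⁿ) ≥ rk M` and the `k₁`-closure of `[M](W ∩ 𝔾ⁿ)` has coordinate ring
`k₁[[M] z]`. [cite: BaysKirby2018ANT, Prop. 7.3 (proof)] -/
theorem rank_le_relRank_k₁ (hH : Hyp G) (M : Matrix (Fin n) (Fin n) ℤ) :
    ((M.map (Int.cast : ℤ → ℚ)).rank : ℕ∞) ≤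
      (algMatroid A.Ω).relRank (σ.k₁ h G P : Set A.Ω)
        (range (matrixAct M (σ.genPt h G P hH.irr))) := by
  have hST : W G ∩ torusLocus A.Ω n ⊆ torusLocus A.Ω n := inter_subset_right
  have hgen := σ.isGenericPt_genPt_inter h G P hH.irr hH.ne
  have hpT := σ.genPt_mem_torusLocus h G P hH.irr hH.ne
  have h1 := (hH.rot M).trans (ZilberGSGC.zariskiDim_image_matrixAct_le_trdeg hST hgen hpT M)
  have h2 : (M.map (Int.cast : ℤ → ℚ)).rank ≤ Cardinal.toNat (Algebra.trdeg (σ.k₁ h G P)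
      (Algebra.adjoin (σ.k₁ h G P) (range (matrixAct M (σ.genPt h G P hH.irr))))) := by
    exact_mod_cast h1
  haveI : Algebra.FiniteType (σ.k₁ h G P)
      (Algebra.adjoin (σ.k₁ h G P) (range (matrixAct M (σ.genPt h G P hH.irr)))) :=
    (Subalgebra.fg_iff_finiteType _).1 (Subalgebra.fg_def.2 ⟨_, finite_range _, rfl⟩)
  exact ZilberGSGC.le_relRank_of_le_toNat_trdeg (σ.k₁ h G P) _
    (Literature.RingTheory.KrullDimension.trdeg_eq_toNat _ _) h2

end Generic

/-! ### Strongness of the step -/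

/-- Subspaces of the (finite-dimensional) domain of a state are finitely generated. [folklore] -/
theorem fg_of_le_D_state (σ' : PState A) {Y : Submodule ℚ A.Ω} (hY : Y ≤ σ'.D) : Y.FG := by
  haveI : FiniteDimensional ℚ σ'.D := FiniteDimensional.span_of_finite ℚ σ'.s.finite_toSet
  haveI : FiniteDimensional ℚ Y := Submodule.finiteDimensional_of_le hY
  exact (Submodule.fg_iff_finiteDimensional Y).2 inferInstance

section Strong

variable [instE : Literature.ModelTheory.ExponentialFields.ExponentialRing A.Ω]
variable {σ : PState A} {n : ℕ} {G : Finset (MvPolynomial (Fin n ⊕ Fin n) A.Ω)} {P : Finset A.Ω}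

/-- **The SEAC step is strong** (for any total exponential `exp` on `Ω` which extends the partial
exponential of the new state): `δ(Y/D) ≥ 0` whenever `D ≤ Y ≤ D + ℚx̄`. With `M` the integer
matrix of all relations of `x̄` modulo `Y`, `ldim(Y/D) = rk M` and
`td(Y/D) ≥ td([M] z/k₁) ≥ rk M` (`rank_le_relRank_k₁`; `gens D ⊆ k₁`, `[M] z = (Mx̄, exp Mx̄)` has
coordinates among the generators of `Y`). [cite: BaysKirby2018ANT, Prop. 7.3]
[cite: Kirby2013FPEF, §3] -/
theorem predim_nonneg_stepSEAC (h : σ.Inv) (hH : Hyp G)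
    (hexp : ∀ e ∈ (stepSEAC G P σ).D,
      ((ExponentialRing.exp e : A.Ω) : ℂ) = (stepSEAC G P σ).E e)
    {Y : Submodule ℚ A.Ω} (h₁ : σ.D ≤ Y) (h₂ : Y ≤ (stepSEAC G P σ).D) :
    0 ≤ predim σ.D Y := by
  classical
  -- the generic point `z = (x, y)` and `exp x = y`
  set z : Fin n ⊕ Fin n → A.Ω := σ.genPt h G P hH.irr with hz
  set x : Fin n → A.Ω := fun i => z (Sum.inl i) with hx
  have hD' : (stepSEAC G P σ).D = σ.D ⊔ Submodule.span ℚ (range x) := D_stepSEAC_of h hH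
  have hexpx : ∀ i, ExponentialRing.exp (x i) = z (Sum.inr i) := by
    intro i
    apply Subtype.ext
    rw [hexp (x i) (by rw [hD']; exact Submodule.mem_sup_right (Submodule.subset_span ⟨i, rfl⟩))]
    exact E_stepSEAC_x h hH i
  have hzγ : z = gammaPt x := by
    funext j
    rcases j with i | i
    · rfl
    · rw [gammaPt_inr, hexpx]
  -- `x` is linearly independent over `D`
  have hli : LinIndepOver σ.D x :=
    ZilberSaturationMain.linIndepOver_of_forall_intCast σ.s rfl
      (σ.genPt_linIndep h G P hH.irr hH.addFree)
  -- `gens D ⊆ k₁`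
  have hgens : gens σ.D ⊆ (σ.k₁ h G P : Set A.Ω) := by
    rintro e (he | ⟨d, hd, rfl⟩)
    · exact σ.D_subset_k₁ h G P he
    · have hdD' : d ∈ (stepSEAC G P σ).D := (le_stepSEAC (G := G) (P := P) σ).D_le hd
      have heq : (ExponentialRing.exp d : A.Ω) = ⟨σ.E d, E_mem_Ω h hd⟩ := by
        apply Subtype.ext
        rw [hexp d hdD']
        exact (le_stepSEAC (G := G) (P := P) σ).E_eq h.good (h.stepSEAC (G := G) (P := P)).good hd
      rw [heq]
      exact σ.E_mem_k₁ h G P hd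
  -- finiteness
  have hfg : IsFG σ.D Y := (fg_of_le_D_state _ h₂).map _
  have hfgx : IsFG σ.D (σ.D ⊔ Submodule.span ℚ (range x)) :=
    isFG_sup_left.2 (isFG_span_of_finite _ (finite_range x))
  -- the relation matrix of `x` modulo `Y`
  obtain ⟨s, M, hrank, hrel, hldim⟩ := ZilberGSGC.exists_relation_matrix Y x
  -- `ldim(Y/D) = s`
  have hn : ldim σ.D (Submodule.span ℚ (range x)) = n := ldim_span_eq_of_linIndepOver hli
  have hldimY : ldim σ.D Y = s := by
    have h2' : Y ≤ σ.D ⊔ Submodule.span ℚ (range x) := hD' ▸ h₂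
    have h3 := ldim_add h₁ h2' hfgx
    rw [ldim_sup_left, hn] at h3
    have h4 : ldim Y (σ.D ⊔ Submodule.span ℚ (range x)) = ldim Y (Submodule.span ℚ (range x)) := by
      rw [← ldim_sup_left Y (σ.D ⊔ Submodule.span ℚ (range x)), ← sup_assoc, sup_eq_left.2 h₁,
        ldim_sup_left]
    rw [h4] at h3
    omega
  -- `td(Y/D) ≥ rk M = s`
  have hsub : range (matrixAct M z) ⊆ gens Y := by
    rintro _ ⟨j, rfl⟩
    rw [hzγ, ZilberSaturationMain.matrixAct_gammaPt]
    rcases j with i | i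
    · rw [gammaPt_inl]; exact mem_gens_of_mem (hrel i)
    · rw [gammaPt_inr]; exact exp_mem_gens (hrel i)
  have htd : ((s : ℕ) : ℕ∞) ≤ td σ.D Y := by
    rw [← hrank, td_def]
    calc ((M.map (Int.cast : ℤ → ℚ)).rank : ℕ∞)
        ≤ (algMatroid A.Ω).relRank (σ.k₁ h G P : Set A.Ω) (range (matrixAct M z)) :=
          σ.rank_le_relRank_k₁ h G P hH M
      _ ≤ (algMatroid A.Ω).relRank (gens σ.D) (range (matrixAct M z)) :=
          (algMatroid A.Ω).relRank_anti_left _ hgens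
      _ ≤ (algMatroid A.Ω).relRank (gens σ.D) (gens Y) :=
          (algMatroid A.Ω).relRank_mono_right _ hsub
  -- conclusion
  have hfin : td σ.D Y ≠ ⊤ := td_ne_top hfg
  have hs : s ≤ (td σ.D Y).toNat := by
    rw [← ENat.coe_toNat hfin] at htd
    exact_mod_cast htd
  rw [predim_def, hldimY]
  omega

/-- **The SEAC step is strong**, packaged for an arbitrary intermediate subspace of the new domain
(the case where the step does not fire being trivial). [cite: BaysKirby2018ANT, Prop. 7.3] -/
theorem predim_nonneg_stepSEAC' (h : σ.Inv)
    (hexp : ∀ e ∈ (stepSEAC G P σ).D,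
      ((ExponentialRing.exp e : A.Ω) : ℂ) = (stepSEAC G P σ).E e)
    {Y : Submodule ℚ A.Ω} (h₁ : σ.D ≤ Y) (h₂ : Y ≤ (stepSEAC G P σ).D) :
    0 ≤ predim σ.D Y := by
  classical
  by_cases hH : Hyp G
  · exact predim_nonneg_stepSEAC h hH hexp h₁ h₂
  · rw [stepSEAC_eq_self_of (fun h' => hH h'.2)] at h₂
    rw [le_antisymm h₂ h₁, predim_self]

end Strong

end PState

end PseudoExpChain

end Literature.NumberTheory.Transcendental
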